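import Literature.Analysis.FunctionSpaces.ThreeStepMomentFunctionalEquation
import HarnessLib

/-!
# The functional equation of the moment function `W₅(s)` of the five-step uniform random walk

For the planar uniform random walk `S₅` let `W₅(s) = E|S₅|^s`. The density `p₅` satisfies
`A₅ · p₅ = 0` with
`A₅ = x⁶(θ+1)⁴ − x⁴(35θ⁴+42θ²+3) + x²(259(θ−1)⁴+104(θ−1)²) − (15(θ−3)(θ−1))²`
[BorweinEtAl2012, Thm. 10], "computed as was that for `p₄`", i.e. as the Mellin translate
(dictionary of §2, Example 1: `θ ↦ −(s+1)`, `x^{2j} ↦ s ↦ s + 2j`) of the functional equation of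
the moments

  `(s+6)⁴ W₅(s+6) − (35(s+5)⁴+42(s+5)²+3) W₅(s+4) + (259(s+4)⁴+104(s+4)²) W₅(s+2)
     − (15(s+2)(s+4))² W₅(s) = 0`,

which in turn comes from the recursion of the even moments `W₅(2k) = Σ_j C(k,j)² W₄(2j)`
(`Literature.Combinatorics.Enumerative.fiveStepMoment_recurrence`) by Carlson's theorem. This file
PROVES the functional equation for `Re s > 0` (`W5_functionalEquation`) via the lifting theorem
`Literature.Analysis.Moments.cmoment_functionalEquation`, together with `momentFn 5 (2k) = W₅(2k)`.

## References

* [BorweinEtAl2012] J. M. Borwein, A. Straub, J. Wan, W. Zudilin, *Densities of short uniform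
  random walks*, Canad. J. Math. 64 (2012) 961–990 (arXiv:1103.2995), §2 (moments, Example 1),
  §5 Thm. 10 (the operator `A₅` and the residue recursion (r5rec)).
* J. M. Borwein, D. Nuyens, A. Straub, J. Wan, *Some arithmetic properties of short random walk
  integrals*, Ramanujan J. 26 (2011) 109–132.
-/

noncomputable section

open MeasureTheory Set Real Complex Filter Polynomial Finset
open scoped Polynomial
open Literature.Analysis.Moments Literature.Combinatorics.Enumerative

namespace Literature.Analysis.FunctionSpaces

/-- `E|S₅|^{2k} = W₅(2k) = Σ_j C(k,j)² D_j`. [cite: BorweinEtAl2012, §1 eq. (1.1)] -/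
theorem integral_pow_normLaw_five (k : ℕ) :
    ∫ x, x ^ (2 * k) ∂(normLaw 5) = (fiveStepMoment k : ℝ) := by
  rw [integral_pow_normLaw, show (5 : ℕ) = 4 + 1 from rfl, integral_norm_pow_succ]
  simp only [integral_norm_pow_four]
  simp only [fiveStepMoment, domb, threeStepMoment]
  push_cast
  rfl

/-- `W₅(2k) = Σ_j C(k,j)² D_j`. [cite: BorweinEtAl2012, §1 eq. (1.1)] -/
theorem momentFn_five_two_mul_natCast (k : ℕ) : momentFn 5 (2 * k) = fiveStepMoment k := by
  rw [momentFn, cmoment_two_mul_natCast, integral_pow_normLaw_five]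
  push_cast
  rfl

/-- **The functional equation of `W₅`** (Mellin translate of `A₅`, [BorweinEtAl2012, Thm. 10]):
for `Re s > 0`,
`(s+6)⁴W₅(s+6) − (35(s+5)⁴+42(s+5)²+3)W₅(s+4) + (259(s+4)⁴+104(s+4)²)W₅(s+2) − (15(s+2)(s+4))²W₅(s) = 0`.
[cite: BorweinEtAl2012, §5 Thm. 10 (operator A₅), §2 Example 1 (Mellin dictionary)] -/
theorem W5_functionalEquation {s : ℂ} (hs : 0 < s.re) :
    (s + 6) ^ 4 * momentFn 5 (s + 6) - (35 * (s + 5) ^ 4 + 42 * (s + 5) ^ 2 + 3) * momentFn 5 (s + 4) +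
        (259 * (s + 4) ^ 4 + 104 * (s + 4) ^ 2) * momentFn 5 (s + 2) -
      (15 * (s + 2) * (s + 4)) ^ 2 * momentFn 5 s = 0 := by
  let P : ℕ → ℂ[X] := fun i =>
    if i = 0 then -(15 * (2 * X + 2) * (2 * X + 4)) ^ 2
      else if i = 1 then 259 * (2 * X + 4) ^ 4 + 104 * (2 * X + 4) ^ 2
      else if i = 2 then -(35 * (2 * X + 5) ^ 4 + 42 * (2 * X + 5) ^ 2 + 3) else (2 * X + 6) ^ 4
  have hP0 : ∀ u : ℂ, (P 0).eval u = -(15 * (2 * u + 2) * (2 * u + 4)) ^ 2 := fun u => by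
    simp [P, eval_pow]
  have hP1 : ∀ u : ℂ, (P 1).eval u = 259 * (2 * u + 4) ^ 4 + 104 * (2 * u + 4) ^ 2 := fun u => by
    simp [P, eval_pow]
  have hP2 : ∀ u : ℂ, (P 2).eval u = -(35 * (2 * u + 5) ^ 4 + 42 * (2 * u + 5) ^ 2 + 3) :=
    fun u => by simp [P, eval_pow]
  have hP3 : ∀ u : ℂ, (P 3).eval u = (2 * u + 6) ^ 4 := fun u => by
    simp [P, eval_pow]
  have hrec : ∀ k : ℕ, ∑ i ∈ range (3 + 1),
      (P i).eval (k : ℂ) * ((∫ x, x ^ (2 * (k + i)) ∂(normLaw 5) : ℝ) : ℂ) = 0 := by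
    intro k
    rw [Finset.sum_range_succ, Finset.sum_range_succ, Finset.sum_range_succ, Finset.sum_range_one,
      hP0, hP1, hP2, hP3]
    simp only [integral_pow_normLaw_five, add_zero]
    have hR := fiveStepMoment_recurrence k
    have hRC : ((k : ℂ) + 3) ^ 4 * (fiveStepMoment (k + 3) : ℂ) +
        ((k : ℂ) + 2) ^ 2 * (259 * ((k : ℂ) + 2) ^ 2 + 26) * (fiveStepMoment (k + 1) : ℂ) =
        (35 * ((k : ℂ) + 2) ^ 4 + 70 * ((k : ℂ) + 2) ^ 3 + 63 * ((k : ℂ) + 2) ^ 2 +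
            28 * ((k : ℂ) + 2) + 5) * (fiveStepMoment (k + 2) : ℂ) +
          225 * (((k : ℂ) + 1) * ((k : ℂ) + 2)) ^ 2 * (fiveStepMoment k : ℂ) := by
      exact_mod_cast hR
    push_cast
    linear_combination (16 : ℂ) * hRC
  have h := cmoment_functionalEquation (μ := normLaw 5) (M := (5 : ℕ)) (d := 3) (P := P)
    (ae_mem_normLaw 5) hrec hs
  rw [Finset.sum_range_succ, Finset.sum_range_succ, Finset.sum_range_succ, Finset.sum_range_one,
    hP0, hP1, hP2, hP3] at h
  have a0 : s + 2 * ((0 : ℕ) : ℂ) = s := by push_cast; ring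
  have a1 : s + 2 * ((1 : ℕ) : ℂ) = s + 2 := by push_cast; ring
  have a2 : s + 2 * ((2 : ℕ) : ℂ) = s + 4 := by push_cast; ring
  have a3 : s + 2 * ((3 : ℕ) : ℂ) = s + 6 := by push_cast; ring
  rw [a0, a1, a2, a3] at h
  unfold momentFn
  linear_combination h

/-- `W₅(0), W₅(2), W₅(4) = 1, 5, 45`. [cite: BorweinEtAl2012, §1 eq. (1.1)] -/
theorem momentFn_five_values : momentFn 5 0 = 1 ∧ momentFn 5 2 = 5 ∧ momentFn 5 4 = 45 := by
  have h0 := momentFn_five_two_mul_natCast 0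
  have h1 := momentFn_five_two_mul_natCast 1
  have h2 := momentFn_five_two_mul_natCast 2
  rw [fiveStepMoment_values.1] at h0
  rw [fiveStepMoment_values.2.1] at h1
  rw [fiveStepMoment_values.2.2.1] at h2
  norm_num at h0 h1 h2
  exact ⟨h0, h1, h2⟩

end Literature.Analysis.FunctionSpaces

end
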